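import Literature.AlgebraicGeometry.ShimuraVarieties.UnitaryBallHolomorphicLift
import Literature.AlgebraicGeometry.HodgeTheory.HodgeModelTopFormOfClass
import HarnessLib

/-!
# The holomorphic top form of a cup product of two `(1,0)`-classes of a ball quotient surface

Topic `AlgebraicGeometry/ShimuraVarieties`; namespace
`Literature.AlgebraicGeometry.ShimuraVarieties.UnitaryBallUniformisationDatum` (continues
`UnitaryBallHolomorphicLift`). Reproduction (kernel): no records, no new hypotheses beyond those of
the two inputs it joins.

Let `X` be a compact ball quotient surface with uniformization datum `D : UnitaryBallUniformisationDatum 2 X`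
and Sylvester frame `𝔣`, read in the STANDARD Hodge model `A := stdModel hHD hX` (`hX := D.isSmoothProjective`).
Two maps of the tree leave `ℂ ⊗_ℚ H^•(X(ℂ); ℚ)` for functions on the ball `𝔹²`:

* in degree one, `D.classLift hHD 𝔣 : ℂ ⊗_ℚ H¹ → (𝔹² → ℂ²)` (`UnitaryBallHolomorphicLift`), the coefficients
  `(α_{ψ z}(dψ_z e₀), α_{ψ z}(dψ_z e₁))` of THE holomorphic `1`-form `α = oneFormOfClassSurface ω` representing a
  `(1,0)`-class `ω` (Voisin I Cor. 7.6);
* in degree two, `A.topFormOfClass hX h76 : ℂ ⊗_ℚ H² → Ω²_hol(X^an)` (`HodgeModelTopFormOfClass`, granted the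
  bijectivity `h76` of the class map `Ω² → H^{2,0}`, Voisin I Cor. 7.6 at `p = 2`) followed by
  `D.formPullback₂ A 𝔣 : Ω² → (𝔹² → ℂ)`, `β ↦ (z ↦ β_{ψ z}(dψ_z e₀, dψ_z e₁))` (`UnitaryBallFormPullback`).

Main result `formPullback₂_topFormOfClass_cup`: **for `ω₁, ω₂ ∈ F¹H¹` the holomorphic `2`-form of the cup
product `ω₁ ∪ ω₂` is the wedge `α₁ ∧ α₂` of the holomorphic representatives** (`topFormOfClass_cup_eq_wedge`),
hence on the ball

  `formPullback₂ (topFormOfClass (ω₁ ∪ ω₂)) z = F₀(z) G₁(z) − F₁(z) G₀(z)`, `F = classLift ω₁`, `G = classLift ω₂`.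

Proof: `Θ_A(ω₁ ∪ ω₂) = Θ_A ω₁ ∪ Θ_A ω₂ = [α₁] ∪ [α₂] = [α₁ ∧ α₂]` (the complexification is multiplicative,
`complexification_cup_one_one`; the standard de Rham family is multiplicative, `complexifyFun_mk_wedge`, Warner
Thm. 5.45), so `ω₁ ∪ ω₂` is of type `(2,0)` and `topFormOfClass (ω₁ ∪ ω₂)` is the holomorphic `2`-form with
class `[α₁ ∧ α₂]`; its difference with `α₁ ∧ α₂` is an exact closed `(2,0)`-form on the compact surface, hence
zero (Voisin I Prop. 7.5 / Cor. 7.6, the tree's `closedForm_top_zero_not_exact`); then evaluate at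
`(dψ_z e₀, dψ_z e₁)` (`wedge_apply_unifDeriv`, Warner 2.10(b)).

Provenance: Hodge-CM model-construction cell (pub-hodgecm), junction (J-Λ) between the `emb` map of
`(2,0)`-classes (`UnitaryBallAdelicLift` ∘ `topFormOfClass`) and the class-map pull-back of `(1,0)`-classes
(`UnitaryBallClassMap.classPull = (Jac g x₀)ᵀ · classLift`): the geometric half "wedge of theta one-forms ↦
global wedge-function".

## References

* C. Voisin, *Hodge Theory and Complex Algebraic Geometry I* (CUP 2002), §7.1.1 Prop. 7.5, Cor. 7.6.
* F. W. Warner, *Foundations of Differentiable Manifolds and Lie Groups*, GTM 94 (1983), 2.10(b), Thm. 5.45.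
* A. Hatcher, *Algebraic Topology* (2002), §3.2 Prop. 3.10.
* A. Borel, *Automorphic forms on `SL₂(ℝ)`* (1997), §5.14.
-/

noncomputable section

open Matrix MulAction Function Set Filter
open scoped Manifold ContDiff Topology TensorProduct
open CategoryTheory
open Literature.Geometry.ComplexHyperbolic
open Literature.Geometry.ComplexHyperbolic.BallModel (U21 Ball Jac nsq actVec)
open Literature.Geometry.Kaehler (MForm IsHolomorphicInCharts holFormsInCharts isOfType_of_mem
  isHolomorphicInCharts_of_mem isSmoothForm_of_mem holFormsInChartsToClosed)
open Literature.NumberTheory.Transcendental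
open Literature.AlgebraicTopology.SingularHomology
open Literature.AlgebraicGeometry.HodgeTheory
open Literature.AlgebraicGeometry.Motives (bettiCohomology ofRatClassBaseChange)

namespace Literature.AlgebraicGeometry.ShimuraVarieties

namespace UnitaryBallUniformisationDatum

variable {X : Motives.SchemeOver ℂ} (D : UnitaryBallUniformisationDatum 2 X)
  (hHD : exists_isReal_hodgeModel) (𝔣 : D.SylvesterFrame)

/-- **The holomorphic top form of a cup product of two `(1,0)`-classes is the wedge of their holomorphic
representatives** (standard Hodge model of the surface; `h76` = bijectivity of the class map `Ω² → H^{2,0}`):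
`topFormOfClass (ω₁ ∪ ω₂) = α₁ ∧ α₂` as `2`-forms on `X^an`, `αᵢ = oneFormOfClassSurface ωᵢ`.
[cite: VoisinHodgeI2002, §7.1.1 Prop. 7.5 and Cor. 7.6] [cite: WarnerGTM94, Thm. 5.45]
[cite: HatcherAT2002, §3.2 Prop. 3.10] -/
theorem topFormOfClass_cup_eq_wedge (hI : hodgePQ_independent_of_hodgeModel)
    {hX : Motives.IsSmoothProjective 2 X}
    (h76 : Function.Bijective (stdModel hHD hX).topHolFormClassPQ)
    {c₁ c₂ : ℂ ⊗[ℚ] bettiCohomology X 1} (hc₁ : c₁ ∈ (BettiUniverse.hodge hHD hX 1).F 1)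
    (hc₂ : c₂ ∈ (BettiUniverse.hodge hHD hX 1).F 1) :
    (((stdModel hHD hX).topFormOfClass hX h76
        (LinearMap.BilinMap.baseChange ℂ (BettiUniverse.cup X 1 1) c₁ c₂) :
        holFormsInCharts (Fin 2 → ℂ) (stdCarrier hX).carrier 2) :
        MForm 𝓘(ℝ, Fin 2 → ℂ) (stdCarrier hX).carrier ℂ 2) =
      ((stdModel hHD hX).oneFormOfClassSurface hX c₁ :
          MForm 𝓘(ℝ, Fin 2 → ℂ) (stdCarrier hX).carrier ℂ 1).wedge
        ((stdModel hHD hX).oneFormOfClassSurface hX c₂ :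
          MForm 𝓘(ℝ, Fin 2 → ℂ) (stdCarrier hX).carrier ℂ 1) := by
  set A := stdModel hHD hX with hA
  set S := stdCarrier hX with hS
  haveI : WedgeFacts 𝓘(ℝ, Fin 2 → ℂ) S.carrier ℝ :=
    wedgeFacts_of_assoc 𝓘(ℝ, Fin 2 → ℂ) S.carrier ℝ (ContinuousAlternatingMap.WedgeAssoc_holds ℝ _ ℝ)
  haveI : WedgeFacts 𝓘(ℝ, Fin 2 → ℂ) S.carrier ℂ :=
    wedgeFacts_of_assoc 𝓘(ℝ, Fin 2 → ℂ) S.carrier ℂ (ContinuousAlternatingMap.WedgeAssoc_holds ℝ _ ℂ)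
  have hcl : A.HolFormsClosed 1 := A.holFormsClosed_of_finrank_succ hX
  have hcp₁ : c₁ ∈ A.ratPiece hX 1 1 0 := mem_ratPiece_stdModel_of_mem_hodge_F hHD hI hX hc₁
  have hcp₂ : c₂ ∈ A.ratPiece hX 1 1 0 := mem_ratPiece_stdModel_of_mem_hodge_F hHD hI hX hc₂
  set α₁ := A.oneFormOfClassSurface hX c₁ with hα₁
  set α₂ := A.oneFormOfClassSurface hX c₂ with hα₂
  -- the closed forms and the wedge
  set a₁ : cclosedSmoothForms (Fin 2 → ℂ) S.carrier 1 := ⟨α₁, hcl α₁⟩ with ha₁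
  set a₂ : cclosedSmoothForms (Fin 2 → ℂ) S.carrier 1 := ⟨α₂, hcl α₂⟩ with ha₂
  set η : MForm 𝓘(ℝ, Fin 2 → ℂ) S.carrier ℂ (1 + 1) :=
    (α₁ : MForm 𝓘(ℝ, Fin 2 → ℂ) S.carrier ℂ 1).wedge (α₂ : MForm 𝓘(ℝ, Fin 2 → ℂ) S.carrier ℂ 1)
    with hη
  have hηc : η ∈ cclosedSmoothForms (Fin 2 → ℂ) S.carrier (1 + 1) :=
    wedge_mem_cclosedSmoothForms a₁.2 a₂.2
  have hηt : IsOfType (1 + 1) 0 η :=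
    IsOfType.wedge_holds (isOfType_of_mem α₁) (isOfType_of_mem α₂)
  -- `Θ cᵢ = (e ⊗ ℂ)[αᵢ]`
  have hΘ : ∀ {c : ℂ ⊗[ℚ] bettiCohomology X 1} (hc : c ∈ A.ratPiece hX 1 1 0),
      A.complexification hX 1 c = complexifyFun (stdFamily 2) 1
        (complexDeRhamCohomology.mk (Fin 2 → ℂ) S.carrier 1
          ⟨(A.oneFormOfClassSurface hX c : MForm 𝓘(ℝ, Fin 2 → ℂ) S.carrier ℂ 1),
            hcl (A.oneFormOfClassSurface hX c)⟩) := by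
    intro c hc
    rw [← A.holFormClass_oneFormOfClassSurface_of_mem_ratPiece hX hc, HodgeModel.holFormClass_apply]
    rfl
  -- `(e ⊗ ℂ)[α₁ ∧ α₂] = Θ(c₁ ∪ c₂)`
  have hclass : complexifyFun (stdFamily 2) (1 + 1)
      (complexDeRhamCohomology.mk (Fin 2 → ℂ) S.carrier (1 + 1) ⟨η, hηc⟩) =
        A.complexification hX (1 + 1) (LinearMap.BilinMap.baseChange ℂ (BettiUniverse.cup X 1 1) c₁ c₂) := by
    have h := complexifyFun_mk_wedge (M := S.carrier) (stdFamily_isMultiplicative 2) a₁ a₂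
    rw [← hΘ hcp₁, ← hΘ hcp₂, ← complexification_cup_one_one A hX] at h
    exact h
  -- the cup product, read in degree `2`, and its holomorphic top form `β`
  set cup : ℂ ⊗[ℚ] bettiCohomology X 2 := LinearMap.BilinMap.baseChange ℂ (BettiUniverse.cup X 1 1) c₁ c₂
    with hcup
  have hclass₂ : A.complexification hX 2 cup =
      A.deRham S.carrier 2 (complexDeRhamCohomology.mk (Fin 2 → ℂ) S.carrier 2 ⟨η, hηc⟩) :=
    hclass.symm
  -- `cup` is of type `(2,0)`: its complexification is the class of the closed `(2,0)`-form `η`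
  have hcupP : cup ∈ A.ratPiece hX 2 2 0 := by
    rw [HodgeModel.mem_ratPiece_iff, hclass₂]
    exact Submodule.mem_map_of_mem (Submodule.subset_span ⟨⟨η, hηc⟩, hηt, rfl⟩)
  set β := A.topFormOfClass hX h76 cup with hβ
  -- `[β] = Θ(cup) = [η]`
  have hmk : complexDeRhamCohomology.mk (Fin 2 → ℂ) S.carrier 2 (holFormsInChartsToClosed A.finrank_model β) =
      complexDeRhamCohomology.mk (Fin 2 → ℂ) S.carrier 2 ⟨η, hηc⟩ := by
    apply (A.deRham S.carrier 2).injective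
    rw [← hclass₂, ← A.topHolFormClass_topFormOfClass_of_mem_ratPiece hX h76 hcupP,
      HodgeModel.topHolFormClass_apply]
  -- hence `β - η` is exact
  have hex : (β : MForm 𝓘(ℝ, Fin 2 → ℂ) S.carrier ℂ 2) - η ∈ cexactSmoothForms (Fin 2 → ℂ) S.carrier 2 := by
    have h := (complexDeRhamCohomology.mk_eq_mk_iff (holFormsInChartsToClosed A.finrank_model β) ⟨η, hηc⟩).1 hmk
    simpa using h
  -- a closed `(2,0)`-form on the compact surface which is exact vanishes
  have hdiff : (β : MForm 𝓘(ℝ, Fin 2 → ℂ) S.carrier ℂ 2) - η = 0 := by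
    by_contra h0
    have hmem : (β : MForm 𝓘(ℝ, Fin 2 → ℂ) S.carrier ℂ 2) - η ∈ cclosedSmoothForms (Fin 2 → ℂ) S.carrier 2 :=
      Submodule.sub_mem _ (holFormsInChartsToClosed A.finrank_model β).2 hηc
    have hs := ((mem_cclosedSmoothForms_iff _).1 hmem).1
    have hc := ((mem_cclosedSmoothForms_iff _).1 hmem).2
    have ht : IsOfType 2 0 ((β : MForm 𝓘(ℝ, Fin 2 → ℂ) S.carrier ℂ 2) - η) := by
      rw [sub_eq_add_neg]
      exact (isOfType_of_mem β).add hηt.neg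
    have hn : Module.finrank ℂ (Fin 2 → ℂ) = 2 := by simp
    exact closedForm_top_zero_not_exact 2 hn _ hs hc ht h0 hex
  exact sub_eq_zero.1 hdiff

/-- **The holomorphic top form of a cup product read on the ball**: for `ω₁, ω₂ ∈ F¹H¹` and `z ∈ 𝔹²`,
`formPullback₂ (topFormOfClass (ω₁ ∪ ω₂)) z = F₀(z) G₁(z) − F₁(z) G₀(z)` with `F = classLift ω₁`, `G = classLift ω₂`
(the wedge of the holomorphic representatives evaluated at `(dψ_z e₀, dψ_z e₁)`).
[cite: VoisinHodgeI2002, §7.1.1 Cor. 7.6] [cite: Warner1983, 2.10(b)] [cite: Borel1997, §5.14] -/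
theorem formPullback₂_topFormOfClass_cup (hI : hodgePQ_independent_of_hodgeModel)
    {hX : Motives.IsSmoothProjective 2 X}
    (h76 : Function.Bijective (stdModel hHD hX).topHolFormClassPQ)
    {c₁ c₂ : ℂ ⊗[ℚ] bettiCohomology X 1} (hc₁ : c₁ ∈ (BettiUniverse.hodge hHD hX 1).F 1)
    (hc₂ : c₂ ∈ (BettiUniverse.hodge hHD hX 1).F 1) (z : Ball) :
    D.formPullback₂ (stdModel hHD hX) 𝔣
        ((stdModel hHD hX).topFormOfClass hX h76
          (LinearMap.BilinMap.baseChange ℂ (BettiUniverse.cup X 1 1) c₁ c₂) :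
          holFormsInCharts (Fin 2 → ℂ) (stdCarrier hX).carrier 2) z =
      D.classLift hHD 𝔣 c₁ z 0 * D.classLift hHD 𝔣 c₂ z 1 -
        D.classLift hHD 𝔣 c₁ z 1 * D.classLift hHD 𝔣 c₂ z 0 := by
  rw [formPullback₂_apply, topFormOfClass_cup_eq_wedge hHD hI h76 hc₁ hc₂, classLift_apply, classLift_apply]
  exact D.wedge_apply_unifDeriv (stdModel hHD hX) 𝔣 _ _ z

end UnitaryBallUniformisationDatum

end Literature.AlgebraicGeometry.ShimuraVarieties

end
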